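import Literature.Geometry.Riemannian.MetricFlowFDistanceTriangleFamily
import Literature.Geometry.Riemannian.MetricFlowFConvergenceTimewise
import Literature.Geometry.Riemannian.GromovW1Complete
import Mathlib.Algebra.Order.Field.GeomSum
import Mathlib.Analysis.SpecificLimits.Basic
import HarnessLib

/-!
# Limits within a correspondence: reindexing, extension by the limit, and the fast chain
# (Bamler 2023, §5.4, Lemma 5.20 — auxiliaries)

R. Bamler, *Compactness theory of the space of super Ricci flows*, Invent. Math. 233 (2023), §5.4,
Lemma 5.20 (arXiv v1 Lemma 121): *"Let `(𝒳ⁱ, (μⁱ_t)_{t ∈ I'^{,i}})`, `i ∈ ℕ`, be a sequence of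
metric flows over `I` that are fully defined over `J`. Consider a correspondence
`ℭ := ((Z_t, d^Z_t)_{t ∈ I}, (φⁱ_t)_{t ∈ I''^{,i}, i ∈ ℕ})` between the metric flows `𝒳ⁱ` over `I`
that is also fully defined over `J` and suppose that the metric spaces `(Z_t, d^Z_t)_{t ∈ I}` are
complete. Suppose that the metric flow pairs … form a Cauchy sequence within `ℭ` that is uniform
over `J` … Then there is a metric flow pair `(𝒳^∞, (μ^∞_t)_{t ∈ I'^{,∞}})` over `I` that is fully
defined over `J` and a family of isometric embeddings `(φ^∞_t : 𝒳^∞_t → Z_t)_{t ∈ I''^{,∞}}`,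
`I''^{,∞} ⊂ I` such that `ℭ' := ((Z_t, d^Z_t)_{t ∈ I}, (φⁱ_t)_{t ∈ I''^{,i}, i ∈ ℕ ∪ {∞}})` is a
correspondence between all metric flows `𝒳ⁱ`, `i ∈ ℕ ∪ {∞}`, and such that we have convergence
`d_𝔽^{ℭ',J}((𝒳ⁱ, (μⁱ_t)), (𝒳^∞, (μ^∞_t))) → 0`."* The printed proof starts with *"As we are
allowed to pass to a subsequence, we may further assume that
`d_𝔽^{ℭ,J}((𝒳ⁱ, (μⁱ_t)), (𝒳^{i+1}, (μ^{i+1}_t))) ≤ 2^{-i-2}`. For each `i` choose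
`E^{i,i+1} ⊂ I` with `J ⊂ I ∖ E^{i,i+1} ⊂ I''^{,i} ∩ I''^{,i+1}` and `(q^{i,i+1}_t)` such that
(1), (2) of Definition 5.6 hold for `r = 2^{-i-1}`. Set `Eⁱ := E^{i,i+1} ∪ E^{i+1,i+2} ∪ …`. Then
`|Eⁱ| ≤ 4^{-i}`"*.

This file provides the book-keeping for the assembly of Lemma 5.20 from the construction of the
limit pair (`MetricFlowFLimitWithin.lean`), in the tree's vocabulary
(`MetricFlow.FamilyCorrespondence`, `MetricFlowPair.FDistAdmissibleWith`):

* `MetricFlow.FamilyCorrespondence.reindex ℭ ψ` — "pass to a subsequence": the correspondence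
  between the flows of `P (ψ k)`, `k ∈ ℕ`, with `(ℭ.reindex ψ).pair k l = ℭ.pair (ψ k) (ψ l)`
  (`rfl`);
* `MetricFlow.FamilyCorrespondence.extend ℭ Pinf ι hι` — **the extended correspondence `ℭ'`**
  between all `𝒳ⁱ`, `i ∈ ℕ ∪ {∞}` (indexed by `Option ℕ`, `none = ∞`): the same comparison spaces,
  `I''^{,∞} := I'^{,∞}` and the embeddings `φ^∞_t := ι_t`; `extend_pair_some_some`,
  `reindex_extend_pair_some_none` (`rfl`);
* accessors of `FDistAdmissibleWith` and `FDistAdmissibleWith.of_subset_diff` (the same witnesses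
  are admissible uniformly over any `J' ⊆ I'' ∖ E`);
* `exists_strictMono_fDistWithinFamily_lt` — the fast subsequence
  `d_𝔽^{ℭ,J}(P (ψ k), P (ψ (k+1))) < 2^{-k}` of a uniformly Cauchy sequence within `ℭ`;
* `fDistWithin_le_of_fast_chain` — along a chain with radii `2^{-n}` admissible with exceptional
  sets `E n`: `d_𝔽^{ℭ, I'' ∖ Eⁱ}(P i, P (i + k)) ≤ 2 · 2^{-i}` for `Eⁱ := ⋃ₖ E (i + k)` (Prop. 5.14
  along the chain; the diagonal `k = 0` through `i + 1`);
* `volume_iUnion_le_of_fast_chain` — `|Eⁱ| ≤ 2 · 4^{-i}`.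

## References

* R. H. Bamler, *Compactness theory of the space of super Ricci flows*, Invent. Math. 233 (2023),
  1121–1277 (arXiv:2008.09298), §5.1 Def. 5.5, Def. 5.6; §5.2 Prop. 5.14; §5.4, Lemma 5.20
  (arXiv v1 Lemma 121). [Bamler2023]
-/

noncomputable section

open Set MeasureTheory Filter TopologicalSpace Function
open scoped Topology ENNReal NNReal

namespace Literature.Geometry.Riemannian

universe u

/-! ### Reindexing along a subsequence and extension by the limit -/

namespace MetricFlow

namespace FamilyCorrespondence

variable {I₀ I'' : Set ℝ} {P : ℕ → MetricFlowPair.{u} I₀}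

/-- **The correspondence along a subsequence** (Bamler 2023, §5.4, proof of Lemma 5.20: "As we
are allowed to pass to a subsequence …"): from a correspondence `ℭ` between the flows of `P n`,
`n ∈ ℕ`, and `ψ : ℕ → ℕ`, the correspondence between the flows of `P (ψ k)`, `k ∈ ℕ`, with the same
comparison spaces, the domains `I''^{,ψ k}` and the embeddings `φ^{ψ k}_t`.
[cite: Bamler2023, §5.4, Lemma 5.20 (arXiv v1 Lemma 121), proof] -/
@[reducible] def reindex (ℭ : FamilyCorrespondence (fun n ↦ (P n).flow) I'') (ψ : ℕ → ℕ) :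
    FamilyCorrespondence (fun k ↦ (P (ψ k)).flow) I'' where
  Z := ℭ.Z
  dom := fun k ↦ ℭ.dom (ψ k)
  dom_subset := fun k ↦ ℭ.dom_subset (ψ k)
  φ := fun k ↦ ℭ.φ (ψ k)
  isometry := fun k ↦ ℭ.isometry (ψ k)

/-- The pair correspondences along a subsequence are those of `ℭ` at the reindexed places
(definitionally). [cite: Bamler2023, §5.4, Lemma 5.20 (arXiv v1 Lemma 121), proof] -/
@[simp] theorem reindex_pair (ℭ : FamilyCorrespondence (fun n ↦ (P n).flow) I'') (ψ : ℕ → ℕ)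
    (k l : ℕ) : (ℭ.reindex ψ).pair k l = ℭ.pair (ψ k) (ψ l) := rfl

/-- A correspondence fully defined over `J` stays fully defined over `J` along a subsequence.
[cite: Bamler2023, §5.4, Lemma 5.20 (arXiv v1 Lemma 121), proof] -/
theorem FullyDefinedOver.reindex {ℭ : FamilyCorrespondence (fun n ↦ (P n).flow) I''} {J : Set ℝ}
    (h : ℭ.FullyDefinedOver J) (ψ : ℕ → ℕ) : (ℭ.reindex ψ).FullyDefinedOver J :=
  fun k ↦ h (ψ k)

/-- **The extended correspondence `ℭ'` of Bamler 2023, Lemma 5.20** ("`ℭ' := ((Z_t, d^Z_t)_{t ∈ I},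
(φⁱ_t)_{t ∈ I''^{,i}, i ∈ ℕ ∪ {∞}})` is a correspondence between all metric flows `𝒳ⁱ`,
`i ∈ ℕ ∪ {∞}`", with "`I'^{,∞} := I''^{,∞}`" and the embeddings `φ^∞_t` of the limit): from a
correspondence `ℭ` over `I₀` between the flows of `P n`, `n ∈ ℕ`, a metric flow pair `P∞` over `I₀`
and isometric embeddings `ι_t : 𝒳^∞_t → Z_t`, `t ∈ I'^{,∞}`, the correspondence indexed by
`Option ℕ` (`some n ↦ 𝒳ⁿ`, `none ↦ 𝒳^∞`) with the same comparison spaces, domains `I''^{,n}` and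
`I''^{,∞} := I'^{,∞}`, and embeddings `φⁿ_t`, `ι_t`.
[cite: Bamler2023, §5.4, Lemma 5.20 (arXiv v1 Lemma 121), (5.27)] -/
@[reducible] def extend (ℭ : FamilyCorrespondence (fun n ↦ (P n).flow) I₀)
    (Pinf : MetricFlowPair.{u} I₀)
    (ι : ∀ (t : ℝ) (ht : t ∈ Pinf.I'), Pinf.flow.Slice ⟨t, ht⟩ → ℭ.Z ⟨t, Pinf.subset ht⟩)
    (hι : ∀ t ht, Isometry (ι t ht)) :
    FamilyCorrespondence (fun o : Option ℕ ↦ (o.elim Pinf P).flow) I₀ where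
  Z := ℭ.Z
  dom := fun o ↦ o.elim Pinf.I' ℭ.dom
  dom_subset := fun o ↦ match o with
    | none => fun _ ht ↦ ⟨ht, Pinf.subset ht⟩
    | some n => ℭ.dom_subset n
  φ := fun o ↦ match o with
    | none => ι
    | some n => ℭ.φ n
  isometry := fun o ↦ match o with
    | none => hι
    | some n => ℭ.isometry n

variable (ℭ : FamilyCorrespondence (fun n ↦ (P n).flow) I₀) (Pinf : MetricFlowPair.{u} I₀)
  (ι : ∀ (t : ℝ) (ht : t ∈ Pinf.I'), Pinf.flow.Slice ⟨t, ht⟩ → ℭ.Z ⟨t, Pinf.subset ht⟩)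
  (hι : ∀ t ht, Isometry (ι t ht))

/-- Between two members of the sequence, the extended correspondence is the original one
(definitionally). [cite: Bamler2023, §5.4, Lemma 5.20 (arXiv v1 Lemma 121), (5.27)] -/
theorem extend_pair_some_some (n m : ℕ) :
    (ℭ.extend Pinf ι hι).pair (some n) (some m) = ℭ.pair n m := rfl

/-- The domain of the limit in the extended correspondence is `I'^{,∞}` (definitionally).
[cite: Bamler2023, §5.4, Lemma 5.20 (arXiv v1 Lemma 121), (5.27)] -/
theorem extend_dom_none : (ℭ.extend Pinf ι hι).dom none = Pinf.I' := rfl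

/-- The domains of the members of the sequence in the extended correspondence are those of `ℭ`
(definitionally). [cite: Bamler2023, §5.4, Lemma 5.20 (arXiv v1 Lemma 121), (5.27)] -/
theorem extend_dom_some (n : ℕ) : (ℭ.extend Pinf ι hι).dom (some n) = ℭ.dom n := rfl

/-- The extended correspondence is fully defined over every `J` over which `ℭ` and `P∞` are.
[cite: Bamler2023, §5.4, Lemma 5.20 (arXiv v1 Lemma 121), (5.27)] -/
theorem FullyDefinedOver.extend {ℭ : FamilyCorrespondence (fun n ↦ (P n).flow) I₀} {J : Set ℝ}
    (h : ℭ.FullyDefinedOver J) {Pinf : MetricFlowPair.{u} I₀} (hinf : Pinf.FullyDefinedOver J)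
    (ι : ∀ (t : ℝ) (ht : t ∈ Pinf.I'), Pinf.flow.Slice ⟨t, ht⟩ → ℭ.Z ⟨t, Pinf.subset ht⟩)
    (hι : ∀ t ht, Isometry (ι t ht)) : (ℭ.extend Pinf ι hι).FullyDefinedOver J := fun o ↦
  match o with
  | none => hinf
  | some n => h n

/-- **Extending after reindexing**: the pair correspondence between `𝒳^{ψ k}` and `𝒳^∞` in the
extension of the reindexed correspondence is the pair correspondence between them in the
extension of `ℭ` (definitionally). [cite: Bamler2023, §5.4, Lemma 5.20 (arXiv v1 Lemma 121), (5.27)] -/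
theorem reindex_extend_pair_some_none (ψ : ℕ → ℕ) (k : ℕ) :
    ((ℭ.reindex ψ).extend Pinf ι hι).pair (some k) none =
      (ℭ.extend Pinf ι hι).pair (some (ψ k)) none := rfl

end FamilyCorrespondence

end MetricFlow

/-! ### Admissibility with a given exceptional set: accessors -/

namespace MetricFlowPair

open MetricFlow

section Accessors

variable {I₁ I₂ : Set ℝ} {P₁ : MetricFlowPair.{u} I₁} {P₂ : MetricFlowPair.{u} I₂} {I'' : Set ℝ}
  {ℭ : Correspondence₂ P₁.flow P₂.flow I''} {J E : Set ℝ} {r : ℝ}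

/-- An admissible radius with exceptional set `E` has `J ⊆ I'' ∖ E`.
[cite: Bamler2023, §5.1, Def. 5.6 (F-distance within correspondence)] -/
theorem FDistAdmissibleWith.subset_diff (h : FDistAdmissibleWith P₁ P₂ ℭ E J r) : J ⊆ I'' \ E :=
  h.2.2.2.1

/-- An admissible radius with exceptional set `E` has `I'' ∖ E ⊆ I''^{,1}`.
[cite: Bamler2023, §5.1, Def. 5.6 (F-distance within correspondence)] -/
theorem FDistAdmissibleWith.diff_subset_dom₁ (h : FDistAdmissibleWith P₁ P₂ ℭ E J r) :
    I'' \ E ⊆ ℭ.dom₁ :=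
  h.2.2.2.2.1

/-- An admissible radius with exceptional set `E` has `I'' ∖ E ⊆ I''^{,2}`.
[cite: Bamler2023, §5.1, Def. 5.6 (F-distance within correspondence)] -/
theorem FDistAdmissibleWith.diff_subset_dom₂ (h : FDistAdmissibleWith P₁ P₂ ℭ E J r) :
    I'' \ E ⊆ ℭ.dom₂ :=
  h.2.2.2.2.2.1

/-- **The same witnesses are admissible uniformly over every `J' ⊆ I'' ∖ E`** (the conditions of
Def. 5.6 mention `J` only through `J ⊆ I'' ∖ E`).
[cite: Bamler2023, §5.1, Def. 5.6 (F-distance within correspondence)] -/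
theorem FDistAdmissibleWith.of_subset_diff (h : FDistAdmissibleWith P₁ P₂ ℭ E J r) {J' : Set ℝ}
    (hJ' : J' ⊆ I'' \ E) : FDistAdmissibleWith P₁ P₂ ℭ E J' r := by
  obtain ⟨hr, hEm, hEI, -, hE₁, hE₂, hvol, q, hq, hint⟩ := h
  exact ⟨hr, hEm, hEI, hJ', hE₁, hE₂, hvol, q, hq, hint⟩

/-- A radius admissible with exceptional set `E` bounds `d_𝔽^{ℭ,J'}` for every `J' ⊆ I'' ∖ E`, in
particular `d_𝔽^{ℭ, I'' ∖ E} ≤ r`. [cite: Bamler2023, §5.1, Def. 5.6 (F-distance within correspondence)] -/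
theorem FDistAdmissibleWith.fDistWithin_le_of_subset_diff (h : FDistAdmissibleWith P₁ P₂ ℭ E J r)
    {J' : Set ℝ} (hJ' : J' ⊆ I'' \ E) : fDistWithin P₁ P₂ ℭ J' ≤ ENNReal.ofReal r :=
  fDistWithin_le (h.of_subset_diff hJ').fDistAdmissible

end Accessors

/-! ### The fast chain -/

/-- `2^{-k}` in `[0, ∞]` is the image of the real number `2^{-k}`. [folklore] -/
theorem inv_two_pow_eq_ofReal (k : ℕ) : (2⁻¹ : ℝ≥0∞) ^ k = ENNReal.ofReal ((2⁻¹ : ℝ) ^ k) := by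
  rw [ENNReal.ofReal_pow (by positivity), ENNReal.ofReal_inv_of_pos two_pos, ENNReal.ofReal_ofNat]

variable {I₀ I'' : Set ℝ}

/-- **"As we are allowed to pass to a subsequence, we may further assume that
`d_𝔽^{ℭ,J}((𝒳ⁱ, (μⁱ_t)), (𝒳^{i+1}, (μ^{i+1}_t))) ≤ 2^{-i-2}`"** (Bamler 2023, proof of Lemma 5.20;
here with the bound `< 2^{-k}`): a sequence uniformly Cauchy within `ℭ` over `J` has a subsequence
`ψ` with `d_𝔽^{ℭ,J}(P (ψ k), P (ψ (k+1))) < 2^{-k}` (`exists_strictMono_lt_of_cauchy`).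
[cite: Bamler2023, §5.4, Lemma 5.20 (arXiv v1 Lemma 121), proof] -/
theorem exists_strictMono_fDistWithinFamily_lt (P : ℕ → MetricFlowPair.{u} I₀)
    (ℭ : FamilyCorrespondence (fun n ↦ (P n).flow) I'') {J : Set ℝ}
    (hC : ∀ ε : ℝ≥0∞, 0 < ε → ∃ N, ∀ i ≥ N, ∀ j ≥ N, fDistWithinFamily P ℭ i j J ≤ ε) :
    ∃ ψ : ℕ → ℕ, StrictMono ψ ∧
      ∀ k, fDistWithinFamily P ℭ (ψ k) (ψ (k + 1)) J < ENNReal.ofReal (2⁻¹ ^ k) := by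
  have hC' : ∀ ε : ℝ≥0∞, 0 < ε → ∃ N, ∀ i ≥ N, ∀ j ≥ N, fDistWithinFamily P ℭ i j J < ε := by
    intro ε hε
    obtain ⟨ε', hε'0, hε'ε⟩ := exists_between hε
    obtain ⟨N, hN⟩ := hC ε' hε'0
    exact ⟨N, fun i hi j hj ↦ (hN i hi j hj).trans_lt hε'ε⟩
  obtain ⟨ψ, hψ, hfast⟩ :=
    exists_strictMono_lt_of_cauchy (G := fun i j ↦ fDistWithinFamily P ℭ i j J) hC'
  exact ⟨ψ, hψ, fun k ↦ by rw [← inv_two_pow_eq_ofReal]; exact hfast k⟩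

/-- **`d_𝔽^{ℭ, I'' ∖ Eⁱ}(P i, P (i + k)) ≤ 2 · 2^{-i}` along a fast chain** (Bamler 2023, proof of
Lemma 5.20: with `Eⁱ := E^{i,i+1} ∪ E^{i+1,i+2} ∪ …` the radii `2^{-l}`, `l ≥ i`, stay admissible
uniformly over `I ∖ Eⁱ`, and Prop. 5.14 along the chain gives
`d_𝔽^{ℭ, I ∖ Eⁱ}(P i, P j) ≤ ∑_{i ≤ l < j} 2^{-l} < 2 · 2^{-i}`; the source's `2^{-i+2}` for its radii
`2^{-i-1}`): for `H`-concentrated pairs `P n` in one correspondence with `2^{-n}` admissible for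
`d_𝔽^{ℭ,J}(P n, P (n+1))` with exceptional set `E n`. The diagonal `k = 0` is estimated through
`i + 1` (Prop. 5.14 and the symmetry of `d_𝔽^{ℭ,J}`).
[cite: Bamler2023, §5.4, Lemma 5.20 (arXiv v1 Lemma 121), proof] -/
theorem fDistWithin_le_of_fast_chain (Q : ℕ → MetricFlowPair.{u} I₀)
    (𝔇 : FamilyCorrespondence (fun n ↦ (Q n).flow) I'')
    (hQ : ∀ n, ∃ H, (Q n).flow.IsHConcentrated H) {J : Set ℝ} {E : ℕ → Set ℝ}
    (hE : ∀ n, FDistAdmissibleWith (Q n) (Q (n + 1)) (𝔇.pair n (n + 1)) (E n) J (2⁻¹ ^ n))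
    (i k : ℕ) :
    fDistWithin (Q i) (Q (i + k)) (𝔇.pair i (i + k)) (I'' \ ⋃ k, E (i + k)) ≤
      ENNReal.ofReal (2 * 2⁻¹ ^ i) := by
  -- the radii `2^{-l}`, `l ≥ i`, are admissible uniformly over `I'' ∖ Eⁱ`
  have hstep : ∀ l, i ≤ l →
      fDistWithinFamily Q 𝔇 l (l + 1) (I'' \ ⋃ k, E (i + k)) ≤ ENNReal.ofReal (2⁻¹ ^ l) := by
    intro l hl
    refine (hE l).fDistWithin_le_of_subset_diff fun t ht ↦ ⟨ht.1, fun h ↦ ht.2 ?_⟩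
    exact mem_iUnion.2 ⟨l - i, by rwa [Nat.add_sub_cancel' hl]⟩
  have h2 : (0 : ℝ) ≤ 2⁻¹ ^ i := by positivity
  obtain _ | k := k
  · -- the diagonal, through `i + 1`
    calc fDistWithin (Q i) (Q (i + 0)) (𝔇.pair i (i + 0)) (I'' \ ⋃ k, E (i + k))
        ≤ fDistWithinFamily Q 𝔇 i (i + 1) (I'' \ ⋃ k, E (i + k)) +
            fDistWithinFamily Q 𝔇 (i + 1) i (I'' \ ⋃ k, E (i + k)) :=
          fDistWithinFamily_triangle Q 𝔇 i (i + 1) i (hQ i) (hQ (i + 1)) (hQ i) _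
      _ ≤ ENNReal.ofReal (2⁻¹ ^ i) + ENNReal.ofReal (2⁻¹ ^ i) :=
          add_le_add (hstep i le_rfl)
            ((fDistWithin_pair_comm Q 𝔇 i (i + 1) _).trans_le (hstep i le_rfl))
      _ = ENNReal.ofReal (2 * 2⁻¹ ^ i) := by rw [two_mul, ENNReal.ofReal_add h2 h2]
  · -- Prop. 5.14 along the chain
    have hik : i < i + (k + 1) := by omega
    calc fDistWithin (Q i) (Q (i + (k + 1))) (𝔇.pair i (i + (k + 1))) (I'' \ ⋃ k, E (i + k))
        ≤ ∑ l ∈ Finset.Ico i (i + (k + 1)),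
            (if i ≤ l then ENNReal.ofReal (2⁻¹ ^ l) else ⊤) := by
          refine fDistWithinFamily_le_of_chain Q 𝔇 hQ
            (d := fun l ↦ if i ≤ l then ENNReal.ofReal (2⁻¹ ^ l) else ⊤) (fun l ↦ ?_) i _ hik
          by_cases hl : i ≤ l
          · rw [if_pos hl]; exact hstep l hl
          · rw [if_neg hl]; exact le_top
      _ = ∑ l ∈ Finset.Ico i (i + (k + 1)), ENNReal.ofReal (2⁻¹ ^ l) :=
          Finset.sum_congr rfl fun l hl ↦ if_pos (Finset.mem_Ico.1 hl).1
      _ = ENNReal.ofReal (∑ l ∈ Finset.Ico i (i + (k + 1)), 2⁻¹ ^ l) :=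
          (ENNReal.ofReal_sum_of_nonneg fun l _ ↦ by positivity).symm
      _ ≤ ENNReal.ofReal (2 * 2⁻¹ ^ i) := by
          refine ENNReal.ofReal_le_ofReal ?_
          calc ∑ l ∈ Finset.Ico i (i + (k + 1)), (2⁻¹ : ℝ) ^ l ≤ 2⁻¹ ^ i / (1 - 2⁻¹) :=
                geom_sum_Ico_le_of_lt_one (by norm_num) (by norm_num)
            _ = 2 * 2⁻¹ ^ i := by norm_num [div_eq_mul_inv, mul_comm]

/-- **`|Eⁱ| ≤ 2 · 4^{-i}` for `Eⁱ := ⋃ₖ E (i + k)`** when `|E n| ≤ (2^{-n})²` (Bamler 2023, proof of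
Lemma 5.20: "`|Eⁱ| ≤ 4^{-i}`" for the source's radii `2^{-i-1}`): `|Eⁱ| ≤ ∑ₖ 4^{-(i+k)} ≤
4^{-i} ∑ₖ 2^{-k} = 2 · 4^{-i}`. [cite: Bamler2023, §5.4, Lemma 5.20 (arXiv v1 Lemma 121), proof] -/
theorem volume_iUnion_le_of_fast_chain {E : ℕ → Set ℝ}
    (hvol : ∀ n, volume (E n) ≤ ENNReal.ofReal ((2⁻¹ ^ n) ^ 2)) (i : ℕ) :
    volume (⋃ k, E (i + k)) ≤ ENNReal.ofReal (2 * (2⁻¹ ^ i) ^ 2) := by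
  have h2 : (0 : ℝ) ≤ (2⁻¹ ^ i) ^ 2 := by positivity
  have hk : ∀ k, volume (E (i + k)) ≤ ENNReal.ofReal ((2⁻¹ ^ i) ^ 2) * 2⁻¹ ^ k := by
    intro k
    calc volume (E (i + k)) ≤ ENNReal.ofReal ((2⁻¹ ^ (i + k)) ^ 2) := hvol (i + k)
      _ ≤ ENNReal.ofReal ((2⁻¹ ^ i) ^ 2 * 2⁻¹ ^ k) := by
          refine ENNReal.ofReal_le_ofReal ?_
          rw [pow_add, mul_pow]
          exact mul_le_mul_of_nonneg_left
            (pow_le_of_le_one (by positivity) (pow_le_one₀ (by positivity) (by norm_num))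
              two_ne_zero) h2
      _ = ENNReal.ofReal ((2⁻¹ ^ i) ^ 2) * 2⁻¹ ^ k := by
          rw [ENNReal.ofReal_mul h2, ← inv_two_pow_eq_ofReal]
  calc volume (⋃ k, E (i + k)) ≤ ∑' k, volume (E (i + k)) := measure_iUnion_le _
    _ ≤ ∑' k, ENNReal.ofReal ((2⁻¹ ^ i) ^ 2) * 2⁻¹ ^ k := ENNReal.tsum_le_tsum hk
    _ = ENNReal.ofReal ((2⁻¹ ^ i) ^ 2) * ∑' k : ℕ, 2⁻¹ ^ k := ENNReal.tsum_mul_left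
    _ = ENNReal.ofReal ((2⁻¹ ^ i) ^ 2) * 2 := by
        rw [ENNReal.tsum_geometric, ENNReal.one_sub_inv_two, inv_inv]
    _ = ENNReal.ofReal (2 * (2⁻¹ ^ i) ^ 2) := by
        rw [mul_comm, ENNReal.ofReal_mul zero_le_two, ENNReal.ofReal_ofNat]

end MetricFlowPair

end Literature.Geometry.Riemannian

end
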